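import Literature.RingTheory.MvPolynomial.MonomialIdealPowersVeronese
import Literature.RingTheory.Flat.RegularFibreFlat
import Literature.AlgebraicGeometry.Resolution.OriginLocalRing
import Literature.AlgebraicGeometry.Resolution.EtaleLocalAlgebra
import Mathlib.RingTheory.Flat.Localization
import Mathlib.RingTheory.Flat.Stability
import HarnessLib

/-!
# [L1 W3.6 · T-AB glue, part 2] Ring level: `K[X] → 𝒪` along a regular system of parameters is FLAT, and the Veronese
# property of squarefree monomial families `((z_i : i ∈ S)^m)_{S ∈ 𝒮}` at a UNIFORM level, from Herzog–Hibi–Trung Cor. 2.2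

Cell `res-hironaka`, rung L, slot W3.6 «ord-pow cut», seat res-L1-s36-pv-2; HOST item stmt-ResolutionOfSingularities-16155
via `--supports`. HONEST FRAMING (D-0012/D-0089): pure commutative algebra; nothing printed in [Hironaka2017] is involved.
AI-produced kernel proofs.

For a regular local ring `R` containing a field `K` with regular system of parameters `z_1, …, z_d` (`(z) = 𝔪`,
`d = emb dim R`), the `K`-algebra map `ψ : K[X_1, …, X_d] → R`, `X_i ↦ z_i`:
* `aeval_sub_algebraMap_constantCoeff_mem_maximalIdeal`, `isUnit_aeval_of_not_mem_originIdeal` — `ψ f ≡ f(0) (mod 𝔪)`,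
  so `ψ` inverts `K[X] ∖ (X)` and factors through `K[X]_{(X)} → R`, a LOCAL homomorphism with `𝔪_{K[X]_{(X)}} R = 𝔪_R`
  (`map_aeval_originIdeal`);
* **`flat_aeval_rsop`** — `R` is flat over `K[X]` via `ψ`: `K[X]_{(X)} → R` is a local homomorphism of regular local rings
  of the same dimension `d` whose fibre `R/𝔪_R` is a field, hence flat (Matsumura Thm. 23.1, tree
  `Literature.RingTheory.Flat.flat_of_isRegularLocalRing_of_isRegularLocalRing_fiber`), and `K[X] → K[X]_{(X)}` is a
  localisation (this is the r.s.p. case of Matsumura Ex. 22.2 / Hartshorne 1966, typed as the fact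
  `Literature.RingTheory.Flat.Matsumura1987_Ex22_2`, which is therefore NOT needed here);
* `map_finsetInf_pow_span_X` — hence `ψ` carries `⨅_{S ∈ 𝒮} (X_S)^m` onto `⨅_{S ∈ 𝒮} (z_S)^m` (Matsumura Thm. 7.4: flat
  extension commutes with finite intersections, tree `Ideal.map_inf_of_flat`);
* `exists_poly_veronese` — Herzog–Hibi–Trung 2007 Cor. 2.2 BY NAME (L-USE fact F-W36-B1
  `Literature.RingTheory.MvPolynomial.HerzogHibiTrung2007_Cor2_2`, res-lit-2 p490554) for the family
  `((X_S))_{S ∈ 𝒮}`: some level `δ > 0` is Veronese (`⨅_S (X_S)^{kδ} ≤ (⨅_S (X_S)^δ)^k` for all `k`);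
  `poly_veronese_mul` — then so is every multiple of `δ`; `exists_uniform_poly_veronese` — ONE level `b₀ > 0` serving
  every `𝒮` on at most `N` letters (product over the finitely many types);
* **`exists_uniform_rsop_veronese`** — the export to the scheme-level glue: given the fact, for every field `K` and bound
  `N` there is `b₀ > 0` such that for every regular local `K`-algebra `R` of embedding dimension `d ≤ N`, every regular
  system of parameters `z` and every `𝒮`: `⨅_S (z_S)^{k b₀} ≤ (⨅_S (z_S)^{b₀})^k` for all `k`.
-/

noncomputable section

set_option linter.dupNamespace false -- mandated namespace of this single-conjunct summit

namespace Summit.ResolutionOfSingularities.ResolutionOfSingularities.Theorems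

open _root_.IsLocalRing _root_.MvPolynomial
open Literature.AlgebraicGeometry.Resolution Literature.RingTheory.MvPolynomial

universe u

namespace CampaignW36

/-! ## `K[X] → R` along a regular system of parameters -/

section Rsop

variable {K : Type u} [Field K] {R : Type u} [CommRing R] [IsRegularLocalRing R] [Algebra K R] {d : ℕ}
  (hd : (maximalIdeal R).spanFinrank = d) (z : Fin d → R) (hz : Ideal.span (Set.range z) = maximalIdeal R)

include hz in
/-- `ψ((X)) = 𝔪_R` for `ψ : X_i ↦ z_i`. [cite: Matsumura1987, §14 (regular system of parameters)] -/
theorem map_aeval_originIdeal :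
    (originIdeal K d).map (aeval z).toRingHom = maximalIdeal R := by
  rw [originIdeal_eq_span, Ideal.map_span, ← Set.range_comp, ← hz]
  congr 2
  funext i
  simp

include hz in
/-- `ψ f ≡ f(0) (mod 𝔪_R)`. [cite: Matsumura1987, §14 (regular system of parameters)] -/
theorem aeval_sub_algebraMap_constantCoeff_mem_maximalIdeal (f : MvPolynomial (Fin d) K) :
    aeval z f - algebraMap K R (constantCoeff f) ∈ maximalIdeal R := by
  have hmem : f - C (constantCoeff f) ∈ originIdeal K d := by
    rw [mem_originIdeal_iff, map_sub, constantCoeff_C, sub_self]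
  have h := Ideal.mem_map_of_mem (aeval z).toRingHom hmem
  rw [map_aeval_originIdeal z hz] at h
  simpa using h

include hz in
/-- `ψ` inverts every polynomial with non-zero constant term (`R` is local). [cite: Matsumura1987, §14 (regular system of parameters)] -/
theorem isUnit_aeval_of_not_mem_originIdeal {s : MvPolynomial (Fin d) K} (hs : s ∉ originIdeal K d) :
    IsUnit (aeval z s) := by
  rw [mem_originIdeal_iff] at hs
  have hu : IsUnit (algebraMap K R (constantCoeff s)) := (Ne.isUnit hs).map _
  have hm := aeval_sub_algebraMap_constantCoeff_mem_maximalIdeal z hz s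
  by_contra h
  have h1 : aeval z s ∈ maximalIdeal R := h
  have h2 : algebraMap K R (constantCoeff s) ∈ maximalIdeal R := by
    have := sub_mem h1 hm
    rwa [sub_sub_cancel] at this
  exact h2 hu

include hd hz in
/-- **`R` is flat over `K[X_1, …, X_d]` via `X ↦ z`** for a regular system of parameters `z` of the regular local ring
`R ⊇ K`: `K[X]_{(X)} → R` is a local homomorphism of regular local rings of dimension `d` with fibre the residue field,
hence flat by Matsumura Thm. 23.1 (tree `flat_of_isRegularLocalRing_of_isRegularLocalRing_fiber`), and `K[X] → K[X]_{(X)}`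
is flat. (The r.s.p. case of Matsumura Ex. 22.2 / Hartshorne 1966.) [cite: Matsumura1987, Thm. 23.1] [cite: Matsumura1987, Ex. 22.2] -/
theorem flat_aeval_rsop :
    letI := (aeval z : MvPolynomial (Fin d) K →ₐ[K] R).toRingHom.toAlgebra
    Module.Flat (MvPolynomial (Fin d) K) R := by
  letI algψ : Algebra (MvPolynomial (Fin d) K) R := (aeval z : MvPolynomial (Fin d) K →ₐ[K] R).toRingHom.toAlgebra
  -- the factorisation `φ : K[X]_{(X)} → R` of `ψ` through the local ring of the origin
  let φ : OriginLocalization K d →+* R :=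
    IsLocalization.lift (M := (originIdeal K d).primeCompl) (S := OriginLocalization K d)
      (g := (aeval z).toRingHom) fun y => isUnit_aeval_of_not_mem_originIdeal z hz y.2
  have hφ : ∀ f : MvPolynomial (Fin d) K, φ (algebraMap _ (OriginLocalization K d) f) = aeval z f :=
    fun f => IsLocalization.lift_eq _ f
  letI algφ : Algebra (OriginLocalization K d) R := φ.toAlgebra
  haveI : IsScalarTower (MvPolynomial (Fin d) K) (OriginLocalization K d) R :=
    IsScalarTower.of_algebraMap_eq (R := MvPolynomial (Fin d) K) (S := OriginLocalization K d) (A := R)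
      fun f => (hφ f).symm
  -- `𝔪_{K[X]_{(X)}} R = ψ((X)) = (z) = 𝔪_R`
  have hmap : (maximalIdeal (OriginLocalization K d)).map (algebraMap (OriginLocalization K d) R) = maximalIdeal R := by
    rw [← IsLocalization.AtPrime.map_eq_maximalIdeal (originIdeal K d) (OriginLocalization K d), Ideal.map_map,
      RingHom.algebraMap_toAlgebra, IsLocalization.lift_comp]
    exact map_aeval_originIdeal z hz
  haveI : IsLocalHom (algebraMap (OriginLocalization K d) R) :=
    ((IsLocalRing.local_hom_TFAE (algebraMap (OriginLocalization K d) R)).out 0 2).mpr hmap.le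
  -- Matsumura 23.1: regular source of dimension `d`, fibre the residue field, target of dimension `d`
  have hflat : Module.Flat (OriginLocalization K d) R := by
    refine Literature.RingTheory.Flat.flat_of_isRegularLocalRing_of_isRegularLocalRing_fiber ?_ ?_
    · rw [hmap]
      exact inferInstanceAs (IsRegularLocalRing (ResidueField R))
    · rw [hmap, ringKrullDim_originLocalization]
      change (d : WithBot ℕ∞) + ringKrullDim (ResidueField R) ≤ ringKrullDim R
      rw [ringKrullDim_eq_zero_of_field, add_zero, ← IsRegularLocalRing.spanFinrank_maximalIdeal, hd]
  haveI : Module.Flat (MvPolynomial (Fin d) K) (OriginLocalization K d) :=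
    IsLocalization.flat (OriginLocalization K d) (originIdeal K d).primeCompl
  exact Module.Flat.trans (MvPolynomial (Fin d) K) (OriginLocalization K d) R

include hd hz in
/-- **`ψ(⨅_{S ∈ 𝒮} (X_S)^m) = ⨅_{S ∈ 𝒮} (z_S)^m`**: extension along the flat `ψ` commutes with finite intersections
(Matsumura Thm. 7.4, tree `Ideal.map_inf_of_flat`) and with powers and spans. [cite: Matsumura1987, Thm. 7.4] -/
theorem map_finsetInf_pow_span_X (𝒮 : Finset (Finset (Fin d))) (m : ℕ) :
    (𝒮.inf fun S => (Ideal.span (X '' (S : Set (Fin d))) : Ideal (MvPolynomial (Fin d) K)) ^ m).map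
        (aeval z : MvPolynomial (Fin d) K →ₐ[K] R).toRingHom =
      𝒮.inf fun S => Ideal.span (z '' (S : Set (Fin d))) ^ m := by
  classical
  letI algψ : Algebra (MvPolynomial (Fin d) K) R := (aeval z : MvPolynomial (Fin d) K →ₐ[K] R).toRingHom.toAlgebra
  haveI := flat_aeval_rsop (K := K) hd z hz
  have hψ : (aeval z : MvPolynomial (Fin d) K →ₐ[K] R).toRingHom = algebraMap (MvPolynomial (Fin d) K) R := rfl
  have hmapinf : ∀ (s : Finset (Finset (Fin d))) (I : Finset (Fin d) → Ideal (MvPolynomial (Fin d) K)),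
      (s.inf I).map (algebraMap (MvPolynomial (Fin d) K) R) =
        s.inf fun S => (I S).map (algebraMap (MvPolynomial (Fin d) K) R) := by
    intro s I
    induction s using Finset.induction_on with
    | empty => rw [Finset.inf_empty, Finset.inf_empty, Ideal.map_top]
    | insert a s ha ih => rw [Finset.inf_insert, Finset.inf_insert, Ideal.map_inf_of_flat, ih]
  rw [hψ, hmapinf]
  congr 1
  funext S
  rw [Ideal.map_pow, Ideal.map_span, ← Set.image_comp]
  congr 3
  funext i
  change aeval z (X i) = z i
  exact aeval_X z i

end Rsop

/-! ## Veronese levels of squarefree monomial families in `K[X]` -/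

section Poly

variable (K : Type u) [Field K]

/-- `(⨅_{S ∈ s} I_S^b)^m ≤ ⨅_{S ∈ s} I_S^{m b}` (any commutative ring). [cite: HerzogHibiTrung2007, Cor. 2.2 (trivial containment)] -/
theorem finsetInf_pow_pow_le {A : Type u} [CommRing A] {ι : Type*} (s : Finset ι) (I : ι → Ideal A) (b m : ℕ) :
    (s.inf fun i => I i ^ b) ^ m ≤ s.inf fun i => I i ^ (m * b) := by
  refine Finset.le_inf fun i hi => ?_
  rw [mul_comm, pow_mul]
  exact Ideal.pow_right_mono (Finset.inf_le hi) m

/-- **A Veronese level stays Veronese at every multiple**: if `⨅_S I_S^{kδ} ≤ (⨅_S I_S^δ)^k` for all `k`, then the same holds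
with `m δ` in place of `δ` (`A^{(δ)}` standard ⇒ `A^{(mδ)}` standard). [cite: HerzogHibiTrung2007, §2 Thm. 2.1 / Cor. 2.2] -/
theorem veronese_mul {A : Type u} [CommRing A] {ι : Type*} (s : Finset ι) (I : ι → Ideal A) {δ : ℕ}
    (h : ∀ k : ℕ, (s.inf fun i => I i ^ (k * δ)) ≤ (s.inf fun i => I i ^ δ) ^ k) (m k : ℕ) :
    (s.inf fun i => I i ^ (k * (m * δ))) ≤ (s.inf fun i => I i ^ (m * δ)) ^ k :=
  calc (s.inf fun i => I i ^ (k * (m * δ))) = s.inf fun i => I i ^ ((k * m) * δ) := by simp_rw [mul_assoc]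
    _ ≤ (s.inf fun i => I i ^ δ) ^ (k * m) := h (k * m)
    _ = ((s.inf fun i => I i ^ δ) ^ m) ^ k := by rw [mul_comm, pow_mul]
    _ ≤ (s.inf fun i => I i ^ (m * δ)) ^ k := Ideal.pow_right_mono (finsetInf_pow_pow_le s I δ m) k

/-- **Herzog–Hibi–Trung Cor. 2.2 for the family `((X_i : i ∈ S))_{S ∈ 𝒮}`** (monomial ideals), BY NAME from the L-USE fact:
some `δ > 0` is a Veronese level. [cite: HerzogHibiTrung2007, Cor. 2.2] -/
theorem exists_poly_veronese (hB1 : HerzogHibiTrung2007_Cor2_2.{u}) {d : ℕ} (𝒮 : Finset (Finset (Fin d))) :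
    ∃ δ : ℕ, 0 < δ ∧ ∀ k : ℕ,
      (𝒮.inf fun S => (Ideal.span (X '' (S : Set (Fin d))) : Ideal (MvPolynomial (Fin d) K)) ^ (k * δ)) ≤
        (𝒮.inf fun S => Ideal.span (X '' (S : Set (Fin d))) ^ δ) ^ k := by
  classical
  -- enumerate `𝒮` by `Fin 𝒮.card`
  let e := 𝒮.equivFin
  let I : Fin 𝒮.card → Ideal (MvPolynomial (Fin d) K) := fun j => Ideal.span (X '' ((e.symm j : Finset (Fin d)) : Set (Fin d)))
  obtain ⟨δ, hδ, hk⟩ := HerzogHibiTrung2007_Cor2_2.iInf_pow_mul_le hB1 K d 𝒮.card I fun j => isMonomial_span_X_image _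
  have hinf : ∀ m : ℕ, (𝒮.inf fun S => (Ideal.span (X '' (S : Set (Fin d))) : Ideal (MvPolynomial (Fin d) K)) ^ m) =
      ⨅ j, I j ^ m := by
    intro m
    apply le_antisymm
    · exact le_iInf fun j => Finset.inf_le (e.symm j).2
    · refine Finset.le_inf fun S hS => ?_
      have : I (e ⟨S, hS⟩) = Ideal.span (X '' (S : Set (Fin d))) := by
        simp only [I, Equiv.symm_apply_apply]
      rw [← this]
      exact iInf_le (fun j => I j ^ m) (e ⟨S, hS⟩)
  refine ⟨δ, hδ, fun k => ?_⟩
  rw [hinf, hinf, mul_comm]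
  exact hk k

/-- **One Veronese level for all squarefree monomial families on at most `N` letters**: the product of the levels of the
finitely many types. [cite: HerzogHibiTrung2007, Cor. 2.2] -/
theorem exists_uniform_poly_veronese (hB1 : HerzogHibiTrung2007_Cor2_2.{u}) (N : ℕ) :
    ∃ b₀ : ℕ, 0 < b₀ ∧ ∀ d : ℕ, d ≤ N → ∀ (𝒮 : Finset (Finset (Fin d))) (k : ℕ),
      (𝒮.inf fun S => (Ideal.span (X '' (S : Set (Fin d))) : Ideal (MvPolynomial (Fin d) K)) ^ (k * b₀)) ≤
        (𝒮.inf fun S => Ideal.span (X '' (S : Set (Fin d))) ^ b₀) ^ k := by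
  classical
  choose δ hδpos hδ using fun (d : ℕ) (𝒮 : Finset (Finset (Fin d))) => exists_poly_veronese K hB1 𝒮
  refine ⟨∏ d ∈ Finset.range (N + 1), ∏ 𝒮 : Finset (Finset (Fin d)), δ d 𝒮, ?_, ?_⟩
  · exact Finset.prod_pos fun d _ => Finset.prod_pos fun 𝒮 _ => hδpos d 𝒮
  · intro d hdN 𝒮 k
    have hdvd : δ d 𝒮 ∣ ∏ d' ∈ Finset.range (N + 1), ∏ 𝒮' : Finset (Finset (Fin d')), δ d' 𝒮' :=
      (Finset.dvd_prod_of_mem _ (Finset.mem_univ 𝒮)).trans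
        (Finset.dvd_prod_of_mem (fun d' => ∏ 𝒮' : Finset (Finset (Fin d')), δ d' 𝒮')
          (Finset.mem_range.mpr (Nat.lt_succ_of_le hdN)))
    obtain ⟨m, hm⟩ := hdvd
    rw [hm, mul_comm (δ d 𝒮) m]
    exact veronese_mul _ _ (hδ d 𝒮) m k

end Poly

/-! ## Export: the uniform ring-level Veronese property at r.s.p. points -/

/-- **Uniform Veronese for squarefree-monomial families of a regular system of parameters** (the B-type ring-level input
of the W3.6 glue), from Herzog–Hibi–Trung Cor. 2.2 BY NAME: for every field `K` and bound `N` there is `b₀ > 0` such that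
for every regular local `K`-algebra `R` with `emb dim R = d ≤ N`, every regular system of parameters `z` of `R`, every
finite family `𝒮` of subsets of the parameters and every `k`: `⨅_{S ∈ 𝒮} (z_S)^{k b₀} ≤ (⨅_{S ∈ 𝒮} (z_S)^{b₀})^k`
(transport of the polynomial statement along the flat `K[X] → R`). [cite: HerzogHibiTrung2007, Cor. 2.2]
[cite: Matsumura1987, Thm. 7.4, Thm. 23.1] -/
theorem exists_uniform_rsop_veronese (hB1 : HerzogHibiTrung2007_Cor2_2.{u}) (K : Type u) [Field K] (N : ℕ) :
    ∃ b₀ : ℕ, 0 < b₀ ∧ ∀ (R : Type u) [CommRing R] [IsRegularLocalRing R] [Algebra K R] (d : ℕ), d ≤ N →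
      ∀ (_ : (maximalIdeal R).spanFinrank = d) (z : Fin d → R) (_ : Ideal.span (Set.range z) = maximalIdeal R)
        (𝒮 : Finset (Finset (Fin d))) (k : ℕ),
        (𝒮.inf fun S => Ideal.span (z '' (S : Set (Fin d))) ^ (k * b₀)) ≤
          (𝒮.inf fun S => Ideal.span (z '' (S : Set (Fin d))) ^ b₀) ^ k := by
  obtain ⟨b₀, hb₀, hV⟩ := exists_uniform_poly_veronese K hB1 N
  refine ⟨b₀, hb₀, fun R _ _ _ d hdN hd z hz 𝒮 k => ?_⟩
  rw [← map_finsetInf_pow_span_X (K := K) hd z hz 𝒮 (k * b₀), ← map_finsetInf_pow_span_X (K := K) hd z hz 𝒮 b₀,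
    ← Ideal.map_pow]
  exact Ideal.map_mono (hV d hdN 𝒮 k)

end CampaignW36

end Summit.ResolutionOfSingularities.ResolutionOfSingularities.Theorems

end
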